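import Summits.BirchSwinnertonDyer.BirchSwinnertonDyer.Theorems.ByReductionTypeAtTwoRankOneAtTwoBigImageOddLocalOneDoorBottomFrameCTFree
import Summits.BirchSwinnertonDyer.BirchSwinnertonDyer.Theorems.ByReductionTypeAtTwoRankOneAtTwoBigImageOddLocalOneDoorBottomOfPrint
import HarnessLib

/-!
# Route ByReductionTypeAtTwo, crux `RankOneAtTwoBigImageOddLocal` (stmt-BirchSwinnertonDyer-23715), LINE v8.12 `one_door_analytic`:
# THE BOTTOM RUNG U₀ FROM FIVE PRINTED FACTS — Cassels–Tate removed from `doorIndexLawUpperCAtTwoBottom_of_print`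

Width prover seat `bsd-line-fkl-p2` g12 (2026-08-28), `--supports stmt-BirchSwinnertonDyer-23715` (helper).  THEOREMS ONLY; no definition, no
named fact introduced, no `sorry`; BSD is not proved by any of this.  CONDITIONAL results: every hypothesis is a PRINT named fact of the tree
(or route GenusKolyvaginAtTwo's item 24880, itself print-conditional).

The lead's `doorIndexLawUpperCAtTwoBottom_of_print` (`Theorems/…OneDoorBottomOfPrint.lean`) gives U₀ (`DoorIndexLawUpperCAtTwoBottom`: at every
minimal door of the slice with an odd constant and a Heegner point with `m = 0`, the `2`-parts of `Ш(W)` and `Ш(W^{(d_K)})` vanish) from SIX printed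
facts: Gross–Zagier, Kolyvagin, modularity, Hoffstein–Luo, Cassels 1962 (`exists_casselsTate_pairing`) and Gross 1991 Prop. 3.7 (2).  With the
CT-free frame `doorIndexLawUpperCAtTwoBottom_of_leaves_ctFree` (`Theorems/…OneDoorBottomFrameCTFree.lean`: the twin `Sel₂` vanishes by Mazur–Rubin
Cor. 3.4 (i) directed at the door's one error place, not by the parity of `dim Sel₂(Wd/ℚ)`) the Cassels–Tate pairing drops out:

* `doorIndexLawUpperCAtTwoBottom_of_kolyvaginRelationAtTwo_ctFree` — U₀ modulo the four primary facts and item 24880;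
* **`doorIndexLawUpperCAtTwoBottom_of_print_ctFree`** — U₀ modulo FIVE printed facts: `gross_zagier`, `kolyvagin`, `exists_isNewformOf`,
  `HoffsteinLuo1997_exists_twist_L_one_ne_zero`, `GrossLMS1991.prop37_2_frobeniusCongruence`.

So the skeleton's `comp` can take `doorIndexLawUpperCAtTwoBottom_of_leaves_ctFree h1.1 h1.2.1 h1.2.2.1 h1.2.2.2 hU0` and the PRINT stub `stub_pubCT`
is no longer an input of the line.

References: [GrossLMS1991] §§3–6, §10, Prop. 3.7 (2); [Kolyvagin1990] Thm. A; [MazurRubin2010] Cor. 3.4 (i); [Kramer1981] Props. 3, 6;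
[Nekovar2007] Prop. 4.9; [HoffsteinLuo1997].
-/

set_option autoImplicit false
-- the Theorems namespace of this sub repeats the summit name by design (D-0017 nested layout)
set_option linter.dupNamespace false

noncomputable section

open scoped Classical

namespace Summit.BirchSwinnertonDyer.BirchSwinnertonDyer.Theorems.RankOneAtTwoOneDoor

open WeierstrassCurve NumberField Literature.NumberTheory.EllipticCurves Literature.NumberTheory.EllipticCurves.ModularForms

/-- **U₀ modulo print + item 24880, WITHOUT Cassels–Tate**: `DoorIndexLawUpperCAtTwoBottom` from Gross–Zagier, Kolyvagin, modularity, Hoffstein–Luo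
and route GenusKolyvaginAtTwo's `KolyvaginRelationAtTwo` (the lead's `firstDescentLeavesAtTwoBottom_of_kolyvaginRelationAtTwo` through the CT-free
frame `doorIndexLawUpperCAtTwoBottom_of_leaves_ctFree`). [cite: GrossLMS1991, §10] [cite: Kolyvagin1990, Thm. A] [cite: MazurRubin2010, Cor. 3.4 (i)] -/
theorem doorIndexLawUpperCAtTwoBottom_of_kolyvaginRelationAtTwo_ctFree
    (hGZ : ∀ (N : ℕ) [NeZero N] (W : WeierstrassCurve ℚ) (K : Type) [Field K] [NumberField K], gross_zagier N W K)
    (hKo : ∀ (N : ℕ) [NeZero N] (W : WeierstrassCurve ℚ) (K : Type) [Field K] [NumberField K], kolyvagin N W K)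
    (hnf : exists_isNewformOf) (hHL : HoffsteinLuo1997_exists_twist_L_one_ne_zero)
    (hrel : Summit.BirchSwinnertonDyer.BirchSwinnertonDyer.Theses.GenusKolyvaginAtTwo.KolyvaginRelationAtTwo) :
    DoorIndexLawUpperCAtTwoBottom :=
  doorIndexLawUpperCAtTwoBottom_of_leaves_ctFree hGZ hKo hnf hHL
    (firstDescentLeavesAtTwoBottom_of_kolyvaginRelationAtTwo hGZ hKo hnf hHL hrel)

/-- **THE BOTTOM RUNG U₀ OF 23715 MODULO FIVE PRINTED FACTS (no Cassels–Tate)**: `DoorIndexLawUpperCAtTwoBottom` — at every minimal door of the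
slice with an odd constant and a Heegner point with `m = 0`, `Ш(W)[2^∞]` and `Ш(W^{(d_K)})[2^∞]` are trivial — from Gross–Zagier 1986, Kolyvagin 1990,
modularity (BCDT 2001), Hoffstein–Luo 1997 and Gross 1991 Prop. 3.7 (2) = Nekovář 2007 Prop. 4.9 (through
`GenusExact.kolyvaginRelationAtTwo_of_frobeniusCongruence`).  CONDITIONAL on these five named facts; nothing about them is proved here; BSD is not
proved by this. [cite: GrossLMS1991, §10 and Prop. 3.7 (2)] [cite: Kolyvagin1990, Thm. A] [cite: Nekovar2007, Prop. 4.9] [cite: MazurRubin2010, Cor. 3.4 (i)] -/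
theorem doorIndexLawUpperCAtTwoBottom_of_print_ctFree
    (hGZ : ∀ (N : ℕ) [NeZero N] (W : WeierstrassCurve ℚ) (K : Type) [Field K] [NumberField K], gross_zagier N W K)
    (hKo : ∀ (N : ℕ) [NeZero N] (W : WeierstrassCurve ℚ) (K : Type) [Field K] [NumberField K], kolyvagin N W K)
    (hnf : exists_isNewformOf) (hHL : HoffsteinLuo1997_exists_twist_L_one_ne_zero)
    (h37 : Literature.NumberTheory.EllipticCurves.GrossLMS1991.prop37_2_frobeniusCongruence) :
    DoorIndexLawUpperCAtTwoBottom :=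
  doorIndexLawUpperCAtTwoBottom_of_kolyvaginRelationAtTwo_ctFree hGZ hKo hnf hHL
    (Summit.BirchSwinnertonDyer.BirchSwinnertonDyer.Theorems.GenusExact.kolyvaginRelationAtTwo_of_frobeniusCongruence h37)

/-- **U₀⁻ modulo the same five printed facts** (the `Δ_W < 0` corner, `doorIndexLawUpperCAtTwoBottomNeg_of_bottom`). [cite: GrossLMS1991, §10]
[cite: Kolyvagin1990, Thm. A] -/
theorem doorIndexLawUpperCAtTwoBottomNeg_of_print_ctFree
    (hGZ : ∀ (N : ℕ) [NeZero N] (W : WeierstrassCurve ℚ) (K : Type) [Field K] [NumberField K], gross_zagier N W K)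
    (hKo : ∀ (N : ℕ) [NeZero N] (W : WeierstrassCurve ℚ) (K : Type) [Field K] [NumberField K], kolyvagin N W K)
    (hnf : exists_isNewformOf) (hHL : HoffsteinLuo1997_exists_twist_L_one_ne_zero)
    (h37 : Literature.NumberTheory.EllipticCurves.GrossLMS1991.prop37_2_frobeniusCongruence) :
    DoorIndexLawUpperCAtTwoBottomNeg :=
  doorIndexLawUpperCAtTwoBottomNeg_of_bottom (doorIndexLawUpperCAtTwoBottom_of_print_ctFree hGZ hKo hnf hHL h37)

end Summit.BirchSwinnertonDyer.BirchSwinnertonDyer.Theorems.RankOneAtTwoOneDoor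

end
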